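import Literature.MathematicalPhysics.QuantumFieldTheory.Balaban1983to89.B16Ineq179
import Literature.MathematicalPhysics.QuantumFieldTheory.Balaban1983to89.B16Cor3Ops

/-!
# `Balaban1983to89.B16Sect1DisplaysPrinted` — [Balaban1989LargeFieldII] §1: the displayed bounds with which the proof of
Theorem 1 concludes (pp. 378–390), BUNDLED BY NAME for one run at one step, as ONE printed claim (typed skeleton;
milestone (A1b) of the cell's NE7b memo `g62/A1-PRINT-READ.md` §3; INTERFACE REQUEST NE7b IR-97-1 of the row OWNER
`t4-ne7b-p1` gen 97 — journal l.46254 [NE7bP1-G97-IR971], INBOX L.37363; owner answer on v1: [NE7bP1-G97-INBOX-3]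
L.37491 «AGREE (a) with C-97-1 + D-97-1∕D-97-2» and ruling F1 (A) = C-97-2 + D-97-3∕D-97-4 [NE7bP1-G97-INBOX-4] on the X-read
chair's pre-read [NE7bLEAF05-G108-PREREAD] L.37563 and lit-balaban r13's F-r13-g54-1, all folded here; typist = gaps seat ne6, INTENT
I-gapsne6-g0-1 l.46171; X-read chair leaf-05 (X-IR971))

HONEST FRAMING.  A `def … : Prop` over ABSTRACT carriers supplied as DATA (`StepCarriers`), in the style of the siblings
`B16.Thm1Printed`, `B14.Thm2Printed`: the printed sentence «the proof of Theorem 1 establishes, at every step k ≤ K of a run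
whose couplings stay in ]0, γ], the displays (1.72), (1.79), p. 383 l. 21–28, (1.80), (1.89), (1.97), (1.99), (1.100)» read as
ONE hypothesis shape whose conjuncts are the EXISTING quoted leaves `B16Cor3Ops.Repr172.Holds`, `B16Ineq179.Ineq179`,
`B16Ineq179.Txt383`, `Step.Budget.ScaleData.Invariant`, `Step.FundIneq189`, `B16.Ineq197`, `B16.Ineq199`, `B16.Ineq1100`
BY NAME — nothing is restated, nothing of Bałaban's is asserted, no proof is claimed (the manuscript [Balaban1989LargeFieldII]
is UNDER AUDIT: 0∕13 main theorems of the series are proved in the tree).  VACUOUS IN ISOLATION (memo g62 §3 (A1b)): with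
carriers chosen freely every conjunct is inhabited by trivial data (the siblings' SANITY examples); the bundle earns its
keep only when the carriers `X` are Bałaban's own objects of (1.71)∕(1.72) — the cell's uncommissioned (α)-instance
(A1c)∕(A2)∕(A3) — at which point a T⁴ record citing `Sect1DisplaysPrinted C X …` is «conditional on NAMED PRINTED FACTS»
instead of «walled on a reading».  Rung (B)+1 context only: NOT the continuum limit, NOT infinite volume, NOT a mass gap,
NOT Clay.  BY-NAME EFFECT ON THE ROW's WALL: NONE until the (A3) junction consumes it (it is the INPUT TYPE of (A2)∕(A3));
NE7b NOT PRINTED ∕ NOT PROVED; spine 0∕9.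

Printed context (verbatim; renders `b2b-balaban-ref1/pages/1989-cmp122-large-field-II/…-p024∕p025∕p026∕p029∕p030∕p033-x2.png`
READ AS IMAGES by this seat; journal page = render + 354).  p. 355 Thm 1: *"If the sequence of the effective coupling
constants is contained in an interval ]0, γ] with a sufficiently small positive γ, then the effective densities ρ_k have
the form, and satisfy all the conditions and bounds, described in Sect. 2 [III]."*; p. 379 (1.72); p. 380 l. 8–9 *"we have
to find a bound of 𝐓′_k(X,(U,0))1, which we denote for simplicity by 𝐓′_k(X)1"*; p. 383 (1.79) and
l. 21–28; p. 384 the inductive statement (1.80); p. 387 (1.89) and l. 23–27 (render p033) *"Next, we have noticed already that the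
inequality (1.79) holds for the 𝐓-operation connected with an arbitrary large field region. The inequality (1.80) holds
quite generally for such regions, hence also an improved bound (1.89), with the additional term −κ₁d_k(X) in the
exponential. This implies the inequality (2.50) [III], hence Corollary 3."*; pp. 389–390 (1.97) (display p035, its «where c₁ = …» clause p036), p. 390 (1.99)–(1.100) (p036).
[Balaban1989LargeFieldII, Thm 1 p. 355; (1.72) p. 379; (1.79) p. 383; (1.80) p. 384; (1.89) p. 387; (1.97)–(1.100) pp. 389–390]

What is here: §1 `StepCarriers D k` (DATA: the carriers of the displays for one run `D : B16.RunData` at step `k`);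
`CoverCarriers D k` (DATA: a SECOND family of operations — the cell reads: the 𝐓″_k(Z_k)-operations of (1.72) ∕
[Balaban1989LargeFieldI] p. 200 and the 𝐓_k(Y_i) of (1.102) p. 390 — with their own admissible families and (1.79)-data);
`Consts` (the letters O(1)'s, M, d, A₀, p₀, β₀, γ₀, A₁, α, β, κ and the profile R(·) of (2.5); `Consts.budget` = the (1.80) letters
read off a run); §2 `DisplaysAt D k X c` (the conjunction at one step), `Coverage D k Y c κ₁` = the coverage sentence p. 387
l. 23–27 as its own clause, BOTH halves — (1.79) for the second family AND the improved (1.89) with −κ₁d_k(X) — (printed as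
a SENTENCE, not a display, and typed as such; owner change C-97-1), and `Sect1DisplaysPrinted C X Y c κ₁` (pattern
`B16.Thm1Printed`: ∃ γ > 0, ∀ runs with `InInterval γ`, ∀ k ≤ K); §3 bookkeeping: the projections a consumer cites
(`holds_of`, `ineq179_of`, `fund189_of`, `ineq1100_of`, `coverage179_of`, `coverage189_of`), by `And` elimination only.
Deliberately NOT here: any operation of (1.71), any measure, any instance; the (α) records' own shapes (Summits side).
-/

namespace Literature.MathematicalPhysics.QuantumFieldTheory.Balaban1983to89.B16Sect1DisplaysPrinted

open Literature.MathematicalPhysics.QuantumFieldTheory.Balaban1983to89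
open B16Ineq179 B16Cor3Ops

/-! ## §1 The carriers (DATA) and the letters -/

/-- **THE CARRIERS OF §1's DISPLAYS FOR ONE RUN AT ONE STEP** (data, no claim): the large-field regions `X` at step `k`
(`Dom`, p. 378 «any component of the first, or of the second class» and p. 387 «an arbitrary large field region»), their
finite admissible sub-history families `adm X` ((1.71) «Σ_{{Ω^c_j∩X, Z_j∩X}, r}»), the total mass `T1 X V = 𝐓′_k(X,(U,0))1`
as a function of the unit-lattice configuration `V` (p. 380 l. 8–9), the per-history geometric data of (1.79) (`dZ`, `comps`,
`primed`, `dC`) and of p. 383 l. 21–28 (`gInt`, `aInt`, `volZΩ`, `volZ`), the (1.80) bookkeeping per scale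
(`Step.Budget.ScaleData`), the polymer∕𝐑′-side carriers of (1.97)–(1.100) (`S : B16.RelDomainSys`, analyticity domains
`dom`, activities `F`, terms `R'`), and (1.72)'s term data `R172 : B16Cor3Ops.Repr172 (D.Cfg k) S.Dom`.  TOTALITY NOTE
(chair F4 ∕ owner D-97-3): `adm`, `T1` and the (1.79)-data here, and every field of `CoverCarriers`, are TOTAL functions on their
domain types; print is silent off the regions that actually carry 𝐓-operations, and there the shapes of §2 are junk-satisfiable
(`T1 := 0`, `adm := {h₀}` — `rhs179 > 0`), so totality forces no vacuity and makes no claim; `Ineq179`'s ∃-spelling presupposes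
`(adm X).Nonempty` at every `X` (a hidden conjunct, as `B16Ineq179`'s own docstring says).  DATA read off print's displays;
nothing claimed. [cite: Balaban1989LargeFieldII, (1.71)-(1.72) pp.378-379 and (1.79) p.383 (the objects named there)] -/
structure StepCarriers (D : B16.RunData) (k : ℕ) where
  /-- large-field regions at step `k`, admissible sub-histories inside a region, component labels of (1.79)'s products -/
  (Dom H ι : Type)
  /-- the finite admissible family of a region ((1.71)'s sum) -/
  adm : Dom → Finset H
  /-- `𝐓′_k(X,(U,0))1` as a function of the configuration -/
  T1 : Dom → D.Cfg k → ℝ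
  /-- (1.79): `d′_j(Z_j)` along a history; the components `Z_j^{(i)}` and the primed components per scale; `d′_j(Z_j^{(i)})` -/
  dZ : H → ℕ → ℝ
  (comps primed : H → ℕ → Finset ι)
  dC : H → ℕ → ι → ℝ
  /-- p. 383 l. 21–28: group-valued integrals, A_j-integrals, volumes |Z_j ∩ Ω_j|, |Z_j| per history and scale -/
  (gInt aInt volZΩ volZ : H → ℕ → ℝ)
  /-- (1.80): the components of `Z_j`, budgets `κ_j(Z)`, size profiles, control horizons, per scale `j` -/
  scaleData : (j : ℕ) → Step.Budget.ScaleData j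
  /-- (1.97)–(1.100): localization domains with the relative size and the «meets ⋃ Y_i» predicate -/
  S : B16.RelDomainSys
  /-- analyticity domains `Ũ^c_k(X, α̃₀, α̃₁)` as sets in a configuration type `Φ` -/
  Φ : Type
  dom : S.Dom → Set Φ
  /-- (1.91)∕(1.97): the activities `F(X′)`; (1.98)–(1.100): the terms `𝐑′^{(k)}(X)` -/
  (F R' : S.Dom → Φ → ℂ)
  /-- (1.72): the term data of the level over the configurations `V_k` and the localization domains -/
  R172 : Repr172 (D.Cfg k) S.Dom

/-- **THE CARRIERS OF THE COVERAGE SENTENCE p. 387 l. 23–27** (data, no claim): a SECOND family of large-field operations at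
step `k` — regions `Dom'` with sizes `dk Y = d_k(Y)`, finite admissible families `adm'`, total masses `T1' Y V` (the operation
applied to 1, as a function of the configuration, p. 380 l. 8–9), and the per-history (1.79)-data `dZ'`, `comps'`, `primed'`,
`dC'`.  The cell reads this family as the 𝐓″_k(Z_k)-operations of (1.72) ([Balaban1989LargeFieldI] p. 200 «operations …
varying from the old T-operations to the integrals as in (1.76)») and the renormalised 𝐓_k(Y_i) of (1.102) p. 390 — LOCATORS
only; print's sentence speaks of «the 𝐓-operation connected with an arbitrary large field region».  Owner change C-97-1.
[cite: Balaban1989LargeFieldII, p.387 l.23-27 (the operations named there)] -/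
structure CoverCarriers (D : B16.RunData) (k : ℕ) where
  /-- the regions of the second operation family, their admissible sub-histories, component labels -/
  (Dom' H' ι' : Type)
  /-- the finite admissible family of a region -/
  adm' : Dom' → Finset H'
  /-- the operation applied to 1, as a function of the configuration -/
  T1' : Dom' → D.Cfg k → ℝ
  /-- (1.79)-data: `d′_j(Z_j)` along a history; components and primed components per history and scale; `d′_j(Z_j^{(i)})` -/
  dZ' : H' → ℕ → ℝ
  (comps' primed' : H' → ℕ → Finset ι')
  dC' : H' → ℕ → ι' → ℝ
  /-- the size `d_k(Y)` entering the improved (1.89) -/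
  dk : Dom' → ℝ

/-- **THE LETTERS FIXED BY THE CONSTRUCTION** (chosen before γ and before the run; print's «O(1)», «absolute constant»,
«constants introduced in the above description») AND ONE PROFILE OF THE RUNNING COUPLING: `C179` the O(1) of (1.79)'s first
exponential (= the O(1) of (1.80)'s summand — the same displayed term, `Step.Budget.Consts.cost`), `C'`∕`C''` the two O(1)'s of
p. 383 l. 21–28, `M`, `d`, `A₀`∕`p₀` of `p₀(g) = A₀(log g⁻²)^{p₀}` ([Balaban1989LargeFieldI] (0.1)), `β₀` of (1.85)–(1.89), `γ₀`∕`A₁`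
of (1.77)–(1.79), `α`∕`β`∕`κ` of (1.68)∕(1.97)–(1.99), `C199` the O(1) of (1.99); and the PROFILE `R : ℝ → ℝ`, `R(g)` = [III] =
[Balaban1988Convergent] (2.5) p. 255 (render p013) *"R_j is the smallest number of the form L^r such, that R_j ≥ (log g_j⁻²)^r"*,
so that `R_j = R(g_j)` is READ OFF THE RUN like `p₀(g_j)` — never a run-frozen step sequence (owner ruling F1 (A) = C-97-2 on
the X-read chair's located finding; lit-balaban F-r13-g54-1).  Symbolic, never valued; letters only; nothing claimed.
[cite: Balaban1989LargeFieldII, p.383 (1.79) and p.384 (1.80) (the constants named there; R(g) per Balaban1988Convergent (2.5) p.255)] -/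
structure Consts where
  (C179 C' C'' M γ₀ A₁ A₀ β₀ α β κ C199 : ℝ)
  (d p₀ : ℕ)
  /-- the profile `R(g)` of (2.5): `R_j = R(g_j)` -/
  R : ℝ → ℝ

/-- The (1.80) budget letters of the b02 lineage's `Step.Budget` currency READ OFF A RUN's flow `g`: the same O(1) `C179`, `M`,
`d`, and the step sequence `n ↦ R(g_n)` (owner ruling C-97-2: no run-frozen `R : ℕ → ℝ`).  Plumbing, no claim. [folklore] -/
def Consts.budget (c : Consts) (g : ℕ → ℝ) : Step.Budget.Consts :=
  ⟨c.C179, c.M, c.d, fun n => c.R (g n)⟩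

/-! ## §2 The displays at one step, and the printed claim for a construction -/

/-- **§1's DISPLAYS AT STEP `k` OF THE RUN `D`, ON THE CARRIERS `X`** — the conjunction, each conjunct an EXISTING quoted
leaf BY NAME, EVERY threshold read off the run's flow `D.flow.g` (`R_j = R(g_j)`, `p₀(g_j)`, `p₀(g_k)`; owner ruling C-97-2): (1.72)
holds for `ρ_k` (`Repr172.Holds`); (1.79) (`Ineq179`); p. 383
l. 21–28 (`Txt383`, cited APART from (1.79)); the inductive statement (1.80) p. 384 at every scale `j ≤ k` IN THE `Step.Budget`
BOOKKEEPING CURRENCY of the b02 lineage (`Step.Budget.ScaleData.Invariant` — a budget-model rendering of the printed statement, not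
a verbatim quoted leaf; owner note D-97-1); (1.89) for every region
(`Step.FundIneq189` at `g_k`); (1.97), (1.99), (1.100) (`B16.Ineq197`∕`Ineq199`∕`Ineq1100` at `p₀(g_k)`).  A `Prop`; nothing
asserted. [cite: Balaban1989LargeFieldII, (1.72) p.379, (1.79) p.383, (1.80) p.384, (1.89) p.387, (1.97) pp.389-390, (1.99)-(1.100) p.390] -/
def DisplaysAt (D : B16.RunData) (k : ℕ) (X : StepCarriers D k) (c : Consts) : Prop :=
  X.R172.Holds (D.ρ k) ∧
  Ineq179 X.adm X.T1 k X.dZ X.comps X.primed X.dC c.C179 c.M c.γ₀ c.A₁ c.d (fun j => c.R (D.flow.g j))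
      (fun j => p0Profile c.A₀ c.p₀ (D.flow.g j)) ∧
  Txt383 X.adm X.gInt X.aInt X.volZΩ X.volZ k c.C' c.C'' c.M c.d (fun j => c.R (D.flow.g j)) ∧
  (∀ j, j ≤ k → (X.scaleData j).Invariant (c.budget D.flow.g)) ∧
  (∀ Y : X.Dom, Step.FundIneq189 (X.T1 Y) c.A₀ c.p₀ c.β₀ (D.flow.g k)) ∧
  B16.Ineq197 X.S X.dom X.F (p0Profile c.A₀ c.p₀ (D.flow.g k)) c.α c.β c.κ ∧
  B16.Ineq199 X.S X.dom X.R' c.C199 (p0Profile c.A₀ c.p₀ (D.flow.g k)) c.α c.β c.κ ∧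
  B16.Ineq1100 X.S X.dom X.R' (p0Profile c.A₀ c.p₀ (D.flow.g k)) c.κ

/-- **THE COVERAGE SENTENCE p. 387 l. 23–27 AS ITS OWN CLAUSE, BOTH HALVES** (render p033), verbatim: *"Next, we have noticed
already that the inequality (1.79) holds for the 𝐓-operation connected with an arbitrary large field region. The inequality
(1.80) holds quite generally for such regions, hence also an improved bound (1.89), with the additional term −κ₁d_k(X) in the
exponential. This implies the inequality (2.50) [III], hence Corollary 3."* — typed for the SECOND operation family `Y`
(the cell reads: the 𝐓″_k(Z_k)-operations of (1.72) ∕ [Balaban1989LargeFieldI] p. 200; the 𝐓_k(Y_i) of (1.102) p. 390 —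
locators) as: FIRST HALF, (1.79) on the family's own admissible histories (`B16Ineq179.Ineq179` BY NAME, `p0 j = p₀(g_j)`
along the run's flow) — the half the cell's R2 reading consumes (`HistRead.tz_le`∕`ty_le` → `forest_le`,
`EtermRead.eterm_le`); SECOND HALF, the improved (1.89) `T1' Y V ≤ exp(−2(1+β₀)⁻¹p₀(g_k) − κ₁ d_k(Y))`.  A SENTENCE of print,
not a display; a `Prop`, nothing asserted.  Owner change C-97-1. [cite: Balaban1989LargeFieldII, p.387 l.23-27] -/
def Coverage (D : B16.RunData) (k : ℕ) (Y : CoverCarriers D k) (c : Consts) (κ₁ : ℝ) : Prop :=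
  Ineq179 Y.adm' Y.T1' k Y.dZ' Y.comps' Y.primed' Y.dC' c.C179 c.M c.γ₀ c.A₁ c.d (fun j => c.R (D.flow.g j))
      (fun j => p0Profile c.A₀ c.p₀ (D.flow.g j)) ∧
  ∀ X V, Y.T1' X V ≤ Real.exp (-(2 * (1 + c.β₀)⁻¹ * p0Profile c.A₀ c.p₀ (D.flow.g k)) - κ₁ * Y.dk X)

/-- **[Balaban1989LargeFieldII] §1's DISPLAYS AS ONE PRINTED CLAIM FOR A CONSTRUCTION** (pattern `B16.Thm1Printed`).  p. 355
Theorem 1, verbatim: *"If the sequence of the effective coupling constants is contained in an interval ]0, γ] with a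
sufficiently small positive γ, then the effective densities ρ_k have the form, and satisfy all the conditions and bounds,
described in Sect. 2 [III]."*; its proof, §1 pp. 356–391, establishes at every step k ≤ K of a run with couplings in ]0, γ]:
the representation (1.72) p. 379 (render p025), the bound (1.79) p. 383 (p029) with the integration∕count sentences p. 383
l. 21–28 and the coverage sentence p. 387 l. 23–27 (p033), the inductive statement (1.80) p. 384 (p030), the fundamental
inequality (1.89) p. 387 (p033), the activity bound (1.97) pp. 389–390 (display p035 last line, «c₁ = …» clause p036), and (1.99)–(1.100) p. 390 (p036).  Typed: for the
carriers `X P k` and the second operation family `Y P k` read off each run `P` at each step `k`, and the construction's letters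
`c`, `κ₁`, *there is γ > 0 such that for every run whose effective couplings satisfy `0 < g_j ≤ γ` (j ≤ K) and every step
`k ≤ K`, `DisplaysAt` holds on `X P k` and `Coverage` on `Y P k`*.  HYPOTHESIS SHAPE: consumed only as
`(h : Sect1DisplaysPrinted C X Y c κ₁)`; never proved here, never asserted; the INPUT TYPE of the cell's (A2)∕(A3) junction.
[cite: Balaban1989LargeFieldII, Thm 1 p.355 with (1.72)-(1.100) pp.379-390] -/
def Sect1DisplaysPrinted (C : B16.Construction) (X : (P : B12.RunParams) → (k : ℕ) → StepCarriers (C P) k)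
    (Y : (P : B12.RunParams) → (k : ℕ) → CoverCarriers (C P) k) (c : Consts) (κ₁ : ℝ) : Prop :=
  ∃ γ : ℝ, 0 < γ ∧ ∀ P : B12.RunParams, (C P).flow.InInterval γ P.K → ∀ k, k ≤ P.K →
    DisplaysAt (C P) k (X P k) c ∧ Coverage (C P) k (Y P k) c κ₁

/-! ## §3 Bookkeeping: what a consumer cites, by `And`-elimination -/

section Proj

variable {C : B16.Construction} {X : (P : B12.RunParams) → (k : ℕ) → StepCarriers (C P) k}
  {Y : (P : B12.RunParams) → (k : ℕ) → CoverCarriers (C P) k} {c : Consts} {κ₁ : ℝ}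

/-- Under the claim, at a run in the window and a step `k ≤ K`: (1.72) holds for `ρ_k` on the run's term data — the (1.72)
conjunct of the printed claim, by `And`-elimination (nothing beyond the hypothesis). [cite: Balaban1989LargeFieldII, (1.72) p.379] -/
theorem holds_of (h : Sect1DisplaysPrinted C X Y c κ₁) :
    ∃ γ : ℝ, 0 < γ ∧ ∀ P : B12.RunParams, (C P).flow.InInterval γ P.K → ∀ k, k ≤ P.K →
      (X P k).R172.Holds ((C P).ρ k) := by
  obtain ⟨γ, hγ, hall⟩ := h
  exact ⟨γ, hγ, fun P hP k hk => ((hall P hP k hk).1).1⟩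

/-- Under the claim: (1.79) on the run's carriers — the (1.79) conjunct, by `And`-elimination. [cite: Balaban1989LargeFieldII, (1.79) p.383] -/
theorem ineq179_of (h : Sect1DisplaysPrinted C X Y c κ₁) :
    ∃ γ : ℝ, 0 < γ ∧ ∀ P : B12.RunParams, (C P).flow.InInterval γ P.K → ∀ k, k ≤ P.K →
      Ineq179 (X P k).adm (X P k).T1 k (X P k).dZ (X P k).comps (X P k).primed (X P k).dC c.C179 c.M c.γ₀ c.A₁ c.d
        (fun j => c.R ((C P).flow.g j)) (fun j => p0Profile c.A₀ c.p₀ ((C P).flow.g j)) := by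
  obtain ⟨γ, hγ, hall⟩ := h
  exact ⟨γ, hγ, fun P hP k hk => ((hall P hP k hk).1).2.1⟩

/-- Under the claim: the fundamental inequality (1.89) for every region of every step in the window — the (1.89) conjunct, by
`And`-elimination. [cite: Balaban1989LargeFieldII, (1.89) p.387] -/
theorem fund189_of (h : Sect1DisplaysPrinted C X Y c κ₁) :
    ∃ γ : ℝ, 0 < γ ∧ ∀ P : B12.RunParams, (C P).flow.InInterval γ P.K → ∀ k, k ≤ P.K →
      ∀ Y : (X P k).Dom, Step.FundIneq189 ((X P k).T1 Y) c.A₀ c.p₀ c.β₀ ((C P).flow.g k) := by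
  obtain ⟨γ, hγ, hall⟩ := h
  exact ⟨γ, hγ, fun P hP k hk => ((hall P hP k hk).1).2.2.2.2.1⟩

/-- Under the claim: (1.100) for the 𝐑′-terms of every step in the window — the (1.100) conjunct, by `And`-elimination.
[cite: Balaban1989LargeFieldII, (1.100) p.390] -/
theorem ineq1100_of (h : Sect1DisplaysPrinted C X Y c κ₁) :
    ∃ γ : ℝ, 0 < γ ∧ ∀ P : B12.RunParams, (C P).flow.InInterval γ P.K → ∀ k, k ≤ P.K →
      B16.Ineq1100 (X P k).S (X P k).dom (X P k).R' (p0Profile c.A₀ c.p₀ ((C P).flow.g k)) c.κ := by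
  obtain ⟨γ, hγ, hall⟩ := h
  exact ⟨γ, hγ, fun P hP k hk => ((hall P hP k hk).1).2.2.2.2.2.2.2⟩

/-- Under the claim: the coverage sentence's FIRST half — (1.79) for the second operation family — by `And`-elimination.
[cite: Balaban1989LargeFieldII, p.387 l.23-27] -/
theorem coverage179_of (h : Sect1DisplaysPrinted C X Y c κ₁) :
    ∃ γ : ℝ, 0 < γ ∧ ∀ P : B12.RunParams, (C P).flow.InInterval γ P.K → ∀ k, k ≤ P.K →
      Ineq179 (Y P k).adm' (Y P k).T1' k (Y P k).dZ' (Y P k).comps' (Y P k).primed' (Y P k).dC' c.C179 c.M c.γ₀ c.A₁ c.d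
        (fun j => c.R ((C P).flow.g j)) (fun j => p0Profile c.A₀ c.p₀ ((C P).flow.g j)) := by
  obtain ⟨γ, hγ, hall⟩ := h
  exact ⟨γ, hγ, fun P hP k hk => ((hall P hP k hk).2).1⟩

/-- Under the claim: the coverage sentence's SECOND half — the improved (1.89) with `−κ₁ d_k` for the second operation
family — by `And`-elimination. [cite: Balaban1989LargeFieldII, p.387 l.23-27] -/
theorem coverage189_of (h : Sect1DisplaysPrinted C X Y c κ₁) :
    ∃ γ : ℝ, 0 < γ ∧ ∀ P : B12.RunParams, (C P).flow.InInterval γ P.K → ∀ k, k ≤ P.K →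
      ∀ Z V, (Y P k).T1' Z V ≤
        Real.exp (-(2 * (1 + c.β₀)⁻¹ * p0Profile c.A₀ c.p₀ ((C P).flow.g k)) - κ₁ * (Y P k).dk Z) := by
  obtain ⟨γ, hγ, hall⟩ := h
  exact ⟨γ, hγ, fun P hP k hk => ((hall P hP k hk).2).2⟩

end Proj

/-! ## §4 Sanity: the SHAPE is inhabited by trivial carriers (non-vacuity of the shape; says NOTHING about Bałaban's objects
— this is exactly the «vacuous in isolation» caveat of memo g62 §3 (A1b)) -/

/-- SANITY (shape non-vacuity only; says NOTHING about Bałaban's objects — the «vacuous in isolation» caveat of memo g62 §3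
(A1b)): the coverage clause on a second family with NO regions holds trivially. [folklore] -/
example (D : B16.RunData) (k : ℕ) (c : Consts) (κ₁ : ℝ) :
    Coverage D k
      { Dom' := Empty, H' := Unit, ι' := Unit, adm' := (fun Y => nomatch Y), T1' := (fun Y => nomatch Y),
        dZ' := (fun _ _ => 0), comps' := (fun _ _ => ∅), primed' := (fun _ _ => ∅), dC' := (fun _ _ _ => 0),
        dk := (fun Y => nomatch Y) } c κ₁ :=
  ⟨(fun Y _ => nomatch Y), (fun Y _ => nomatch Y)⟩

end Literature.MathematicalPhysics.QuantumFieldTheory.Balaban1983to89.B16Sect1DisplaysPrinted
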